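import Mathlib.MeasureTheory.Integral.MeanInequalities
import Mathlib.Analysis.SpecialFunctions.Pow.NNReal
import Mathlib.Analysis.SpecialFunctions.Log.Basic
import Mathlib.MeasureTheory.Measure.Typeclasses.Probability
import HarnessLib

/-!
# Crux `RestartPrinciple` (stmt-AtomisticToContinuum-12503), line `isentropic-regibbsification` —
# exponential moments of a sum from a one-sided large-deviation bound (Cauchy–Schwarz / truncation)

Support file for the lead's stub `stub_renyiLocalEquilibrium`. After the Liouville identity
(`RelayRaceLocalityRestartPrincipleRenyiTransport`), `(N+1)⁻¹ D_{1+γ}((Φ_r)_* G_s ‖ G_t)` is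
`γ⁻¹ (N+1)⁻¹ log E_{G_s} e^{γ (X_N + Y_N)}` up to centring constants, with `X_N` the STATIC
log-likelihood fluctuation at the restart time and `Y_N` the DROP of the log-likelihood pairing
along the flow. This file proves the abstract analytic step of the card's reduction (R2):

* `lintegral_exp_mul_add_le_of_largeDeviation` — if (i) the exponential moments of `X_N` are
  sub-exponentially flat (`E e^{γ X_N} ≤ e^{γ ε n_N}` for all small `γ`, every `ε`), (ii) `Y_N` has
  SOME exponential moment of order `n_N` (`E e^{γ Y_N} ≤ e^{γ K n_N}`, small `γ`), and (iii) the
  upper tail of `Y_N` at scale `n_N` is exponentially small (`P(Y_N > δ n_N) ≤ C e^{-n_N/C}`, every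
  `δ`), then `E e^{γ (X_N + Y_N)} ≤ e^{γ ε n_N}` eventually, for every `ε` and a suitable `γ(ε) > 0`.

Proof: Cauchy–Schwarz `E e^{γ(X+Y)} ≤ (E e^{2γX})^{1/2} (E e^{2γY})^{1/2}`; split `E e^{2γY}` on
`{Y ≤ δ n}` (bounded by `e^{2γδn}`) and `{Y > δ n}` (Cauchy–Schwarz again:
`≤ P(Y > δn)^{1/2} (E e^{4γY})^{1/2} ≤ (C e^{-n/C} e^{4γKn})^{1/2} ≤ 1` once `4γK ≤ 1/(4C)` and
`n` is large). Pure measure theory in `ℝ≥0∞`; no physics.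
-/

noncomputable section

open MeasureTheory Set Filter
open scoped ENNReal

namespace Summit.AtomisticToContinuum.HydrodynamicLimit.Theorems.RestartPrinciple.IsentropicRegibbsification

/-- `(e^y)^p = e^{p y}` in `ℝ≥0∞` for `0 ≤ p`. [folklore] -/
private theorem ofReal_exp_rpow' {p : ℝ} (hp : 0 ≤ p) (y : ℝ) :
    ENNReal.ofReal (Real.exp y) ^ p = ENNReal.ofReal (Real.exp (p * y)) := by
  rw [ENNReal.ofReal_rpow_of_nonneg (Real.exp_pos y).le hp, ← Real.exp_mul, mul_comm]

/-- `e^a · e^b = e^{a+b}` in `ℝ≥0∞`. [folklore] -/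
private theorem ofReal_exp_mul_ofReal_exp (a b : ℝ) :
    ENNReal.ofReal (Real.exp a) * ENNReal.ofReal (Real.exp b) = ENNReal.ofReal (Real.exp (a + b)) := by
  rw [← ENNReal.ofReal_mul (Real.exp_pos a).le, Real.exp_add]

/-- Square root of `ofReal`: `(ofReal x)^{1/2} = ofReal (x^{1/2})` for `0 ≤ x`. [folklore] -/
private theorem ofReal_rpow_half {x : ℝ} (hx : 0 ≤ x) :
    ENNReal.ofReal x ^ (1 / (2 : ℝ)) = ENNReal.ofReal (x ^ (1 / (2 : ℝ))) :=
  ENNReal.ofReal_rpow_of_nonneg hx (by norm_num)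

/-- Cauchy–Schwarz for exponential moments: `E e^{γ(X+Y)} ≤ (E e^{2γX})^{1/2} (E e^{2γY})^{1/2}`.
[folklore] -/
theorem lintegral_exp_mul_add_le_sqrt_mul_sqrt {α : Type*} [MeasurableSpace α] (μ : Measure α)
    {X Y : α → ℝ} (hX : Measurable X) (hY : Measurable Y) (γ : ℝ) :
    ∫⁻ ω, ENNReal.ofReal (Real.exp (γ * (X ω + Y ω))) ∂μ ≤
      (∫⁻ ω, ENNReal.ofReal (Real.exp (2 * γ * X ω)) ∂μ) ^ (1 / (2 : ℝ)) *
        (∫⁻ ω, ENNReal.ofReal (Real.exp (2 * γ * Y ω)) ∂μ) ^ (1 / (2 : ℝ)) := by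
  have hf : AEMeasurable (fun ω => ENNReal.ofReal (Real.exp (γ * X ω))) μ :=
    ((measurable_const.mul hX).exp.ennreal_ofReal).aemeasurable
  have hg : AEMeasurable (fun ω => ENNReal.ofReal (Real.exp (γ * Y ω))) μ :=
    ((measurable_const.mul hY).exp.ennreal_ofReal).aemeasurable
  have h := ENNReal.lintegral_mul_le_Lp_mul_Lq μ Real.HolderConjugate.two_two hf hg
  have hlhs : (fun ω => ENNReal.ofReal (Real.exp (γ * (X ω + Y ω)))) =
      (fun ω => ENNReal.ofReal (Real.exp (γ * X ω))) * fun ω => ENNReal.ofReal (Real.exp (γ * Y ω)) := by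
    funext ω
    simp only [Pi.mul_apply, ofReal_exp_mul_ofReal_exp, mul_add]
  rw [hlhs]
  refine h.trans_eq ?_
  congr 2
  · refine lintegral_congr fun ω => ?_
    rw [ofReal_exp_rpow' (by norm_num : (0 : ℝ) ≤ 2), ← mul_assoc]
  · refine lintegral_congr fun ω => ?_
    rw [ofReal_exp_rpow' (by norm_num : (0 : ℝ) ≤ 2), ← mul_assoc]

/-- Truncation bound: `E e^{θ Y} ≤ e^{θ b} + P(Y > b)^{1/2} (E e^{2θY})^{1/2}` for `θ ≥ 0`, for a
measure of total mass at most one. [folklore] -/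
theorem lintegral_exp_mul_le_exp_add_sqrt {α : Type*} [MeasurableSpace α] (μ : Measure α)
    [IsProbabilityMeasure μ] {Y : α → ℝ} (hY : Measurable Y) {θ : ℝ} (hθ : 0 ≤ θ) (b : ℝ) :
    ∫⁻ ω, ENNReal.ofReal (Real.exp (θ * Y ω)) ∂μ ≤
      ENNReal.ofReal (Real.exp (θ * b)) +
        (μ {ω | b < Y ω}) ^ (1 / (2 : ℝ)) *
          (∫⁻ ω, ENNReal.ofReal (Real.exp (2 * θ * Y ω)) ∂μ) ^ (1 / (2 : ℝ)) := by
  set A : Set α := {ω | b < Y ω} with hA_def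
  have hA : MeasurableSet A := measurableSet_lt measurable_const hY
  have hfm : Measurable fun ω => ENNReal.ofReal (Real.exp (θ * Y ω)) :=
    (measurable_const.mul hY).exp.ennreal_ofReal
  rw [← lintegral_add_compl _ hA, add_comm]
  gcongr
  · -- on `Aᶜ = {Y ≤ b}` the integrand is at most `e^{θ b}` and the mass at most one
    calc ∫⁻ ω in Aᶜ, ENNReal.ofReal (Real.exp (θ * Y ω)) ∂μ
        ≤ ∫⁻ ω in Aᶜ, ENNReal.ofReal (Real.exp (θ * b)) ∂μ := by
          refine setLIntegral_mono measurable_const fun ω hω => ?_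
          have hle : Y ω ≤ b := not_lt.1 (by simpa [hA_def] using hω)
          exact ENNReal.ofReal_le_ofReal (Real.exp_le_exp.2 (mul_le_mul_of_nonneg_left hle hθ))
      _ ≤ ENNReal.ofReal (Real.exp (θ * b)) := by
          rw [setLIntegral_const]
          calc ENNReal.ofReal (Real.exp (θ * b)) * μ Aᶜ
              ≤ ENNReal.ofReal (Real.exp (θ * b)) * 1 := by gcongr; exact prob_le_one
            _ = _ := mul_one _
  · -- on `A`: Cauchy–Schwarz against the indicator
    have h1 : ∫⁻ ω in A, ENNReal.ofReal (Real.exp (θ * Y ω)) ∂μ =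
        ∫⁻ ω, (A.indicator (fun _ => (1 : ℝ≥0∞)) * fun ω => ENNReal.ofReal (Real.exp (θ * Y ω))) ω ∂μ := by
      rw [← lintegral_indicator hA]
      refine lintegral_congr fun ω => ?_
      simp only [Pi.mul_apply, Set.indicator_apply]
      split_ifs <;> simp
    rw [h1]
    have hind : AEMeasurable (A.indicator fun _ => (1 : ℝ≥0∞)) μ :=
      (measurable_const.indicator hA).aemeasurable
    refine (ENNReal.lintegral_mul_le_Lp_mul_Lq μ Real.HolderConjugate.two_two hind
      hfm.aemeasurable).trans_eq ?_
    congr 2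
    · have : (fun ω => A.indicator (fun _ => (1 : ℝ≥0∞)) ω ^ (2 : ℝ)) = A.indicator fun _ => 1 := by
        funext ω
        simp only [Set.indicator_apply]
        split_ifs <;> simp
      rw [this, lintegral_indicator hA, setLIntegral_const, one_mul]
    · refine lintegral_congr fun ω => ?_
      rw [ofReal_exp_rpow' (by norm_num : (0 : ℝ) ≤ 2), ← mul_assoc]

/-- **Exponential moments of a sum from a one-sided large-deviation bound** (the analytic core of
the card's reduction (R2): "Rényi term ⟸ one-sided no-anomalous-dissipation LD + static moments").
Laws `μ N` of mass one, real observables `X N, Y N`, a scale `n N → ∞`. Hypotheses: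
(i) `∀ ε > 0 ∃ γ₁ > 0 ∀ γ ∈ (0, γ₁], ∀ᶠ N, E e^{γ X_N} ≤ e^{γ ε n_N}` (static moment flatness);
(ii) `∃ K ∃ γ₂ > 0 ∀ γ ∈ (0, γ₂], ∀ᶠ N, E e^{γ Y_N} ≤ e^{γ K n_N}` (a-priori exponential moment);
(iii) `∀ δ > 0 ∃ C > 0, ∀ᶠ N, P(Y_N > δ n_N) ≤ C e^{-n_N / C}` (one-sided large deviations).
Conclusion: `∀ ε > 0 ∃ γ > 0, ∀ᶠ N, E e^{γ (X_N + Y_N)} ≤ e^{γ ε n_N}`. [folklore] -/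
theorem lintegral_exp_mul_add_le_of_largeDeviation {Ω : ℕ → Type*} [∀ N, MeasurableSpace (Ω N)]
    (μ : (N : ℕ) → Measure (Ω N))
    [∀ N, IsProbabilityMeasure (μ N)] (X Y : (N : ℕ) → Ω N → ℝ) (hX : ∀ N, Measurable (X N))
    (hY : ∀ N, Measurable (Y N)) (n : ℕ → ℝ) (hn : Tendsto n atTop atTop)
    (hXmom : ∀ ε : ℝ, 0 < ε → ∃ γ₁ : ℝ, 0 < γ₁ ∧ ∀ γ : ℝ, 0 < γ → γ ≤ γ₁ → ∀ᶠ N in atTop,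
      ∫⁻ ω, ENNReal.ofReal (Real.exp (γ * X N ω)) ∂μ N ≤ ENNReal.ofReal (Real.exp (γ * ε * n N)))
    (hYmom : ∃ K : ℝ, ∃ γ₂ : ℝ, 0 < γ₂ ∧ ∀ γ : ℝ, 0 < γ → γ ≤ γ₂ → ∀ᶠ N in atTop,
      ∫⁻ ω, ENNReal.ofReal (Real.exp (γ * Y N ω)) ∂μ N ≤ ENNReal.ofReal (Real.exp (γ * K * n N)))
    (hYld : ∀ δ : ℝ, 0 < δ → ∃ C : ℝ, 0 < C ∧ ∀ᶠ N in atTop,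
      μ N {ω | δ * n N < Y N ω} ≤ ENNReal.ofReal (C * Real.exp (-(C⁻¹ * n N)))) :
    ∀ ε : ℝ, 0 < ε → ∃ γ : ℝ, 0 < γ ∧ ∀ᶠ N in atTop,
      ∫⁻ ω, ENNReal.ofReal (Real.exp (γ * (X N ω + Y N ω))) ∂μ N ≤
        ENNReal.ofReal (Real.exp (γ * ε * n N)) := by
  intro ε hε
  -- constants
  obtain ⟨γ₁, hγ₁, hXb⟩ := hXmom (ε / 4) (by positivity)
  obtain ⟨K, γ₂, hγ₂, hYb⟩ := hYmom
  set K' : ℝ := max K 1 with hK'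
  have hK'pos : 0 < K' := lt_of_lt_of_le one_pos (le_max_right _ _)
  have hKK' : K ≤ K' := le_max_left _ _
  obtain ⟨C, hC, hld⟩ := hYld (ε / 4) (by positivity)
  set γ : ℝ := min (γ₁ / 2) (min (γ₂ / 4) (1 / (16 * C * K'))) with hγ_def
  have hγpos : 0 < γ := by positivity
  have hγ1 : 2 * γ ≤ γ₁ := by
    have : γ ≤ γ₁ / 2 := min_le_left _ _
    linarith
  have hγ2 : 4 * γ ≤ γ₂ := by
    have : γ ≤ γ₂ / 4 := (min_le_right _ _).trans (min_le_left _ _)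
    linarith
  have hγ3 : 4 * γ * K' ≤ 1 / (4 * C) := by
    have h : γ ≤ 1 / (16 * C * K') := (min_le_right _ _).trans (min_le_right _ _)
    rw [le_div_iff₀ (by positivity)] at h
    rw [le_div_iff₀ (by positivity)]
    nlinarith
  refine ⟨γ, hγpos, ?_⟩
  -- the eventual bounds
  have hX2 := hXb (2 * γ) (by positivity) hγ1
  have hY4 := hYb (4 * γ) (by positivity) hγ2
  have hn1 : ∀ᶠ N in atTop, 4 * C / 3 * Real.log C ≤ n N := hn.eventually_ge_atTop _
  have hn2 : ∀ᶠ N in atTop, Real.log 2 / (γ * ε) ≤ n N := hn.eventually_ge_atTop _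
  have hn0 : ∀ᶠ N in atTop, 0 ≤ n N := hn.eventually_ge_atTop 0
  filter_upwards [hX2, hY4, hld, hn1, hn2, hn0] with N hXN hYN hldN hn1N hn2N hn0N
  -- Step 1: Cauchy–Schwarz
  refine (lintegral_exp_mul_add_le_sqrt_mul_sqrt (μ N) (hX N) (hY N) γ).trans ?_
  -- Step 2: the `X` factor
  have hXfac : (∫⁻ ω, ENNReal.ofReal (Real.exp (2 * γ * X N ω)) ∂μ N) ^ (1 / (2 : ℝ)) ≤
      ENNReal.ofReal (Real.exp (γ * (ε / 4) * n N)) := by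
    calc (∫⁻ ω, ENNReal.ofReal (Real.exp (2 * γ * X N ω)) ∂μ N) ^ (1 / (2 : ℝ))
        ≤ (ENNReal.ofReal (Real.exp (2 * γ * (ε / 4) * n N))) ^ (1 / (2 : ℝ)) := by
          gcongr
      _ = ENNReal.ofReal (Real.exp (γ * (ε / 4) * n N)) := by
          rw [ofReal_exp_rpow' (by norm_num : (0 : ℝ) ≤ 1 / 2)]
          congr 2
          ring
  -- Step 3: the `Y` factor, by truncation at level `(ε/4) n`
  have hYtrunc := lintegral_exp_mul_le_exp_add_sqrt (μ N) (hY N) (θ := 2 * γ) (by positivity)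
    (ε / 4 * n N)
  have htail : (μ N {ω | ε / 4 * n N < Y N ω}) ^ (1 / (2 : ℝ)) *
      (∫⁻ ω, ENNReal.ofReal (Real.exp (2 * (2 * γ) * Y N ω)) ∂μ N) ^ (1 / (2 : ℝ)) ≤ 1 := by
    have h4 : (∫⁻ ω, ENNReal.ofReal (Real.exp (2 * (2 * γ) * Y N ω)) ∂μ N) ≤
        ENNReal.ofReal (Real.exp (4 * γ * K' * n N)) := by
      have h' : (fun ω => ENNReal.ofReal (Real.exp (2 * (2 * γ) * Y N ω))) =
          fun ω => ENNReal.ofReal (Real.exp (4 * γ * Y N ω)) := by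
        funext ω; congr 2; ring
      rw [h']
      refine hYN.trans (ENNReal.ofReal_le_ofReal (Real.exp_le_exp.2 ?_))
      have : 4 * γ * K * n N ≤ 4 * γ * K' * n N := by
        apply mul_le_mul_of_nonneg_right _ hn0N
        exact mul_le_mul_of_nonneg_left hKK' (by positivity)
      exact this
    calc (μ N {ω | ε / 4 * n N < Y N ω}) ^ (1 / (2 : ℝ)) *
          (∫⁻ ω, ENNReal.ofReal (Real.exp (2 * (2 * γ) * Y N ω)) ∂μ N) ^ (1 / (2 : ℝ))
        ≤ (ENNReal.ofReal (C * Real.exp (-(C⁻¹ * n N)))) ^ (1 / (2 : ℝ)) *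
            (ENNReal.ofReal (Real.exp (4 * γ * K' * n N))) ^ (1 / (2 : ℝ)) := by
          gcongr
      _ = ENNReal.ofReal ((C * Real.exp (-(C⁻¹ * n N)) * Real.exp (4 * γ * K' * n N)) ^
            (1 / (2 : ℝ))) := by
          rw [ofReal_rpow_half (by positivity), ofReal_rpow_half (by positivity),
            ← ENNReal.ofReal_mul (by positivity),
            ← Real.mul_rpow (by positivity) (by positivity)]
      _ ≤ ENNReal.ofReal 1 := by
          refine ENNReal.ofReal_le_ofReal ?_
          have hbase : C * Real.exp (-(C⁻¹ * n N)) * Real.exp (4 * γ * K' * n N) ≤ 1 := by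
            -- `C e^{-n/C} e^{4γK' n} ≤ C e^{-3n/(4C)} ≤ 1` since `4γK' ≤ 1/(4C)`, `n ≥ (4C/3) log C`
            have hexp : -(C⁻¹ * n N) + 4 * γ * K' * n N ≤ -(3 / (4 * C)) * n N := by
              have h1 : 4 * γ * K' * n N ≤ 1 / (4 * C) * n N :=
                mul_le_mul_of_nonneg_right hγ3 hn0N
              have h2 : -(C⁻¹ * n N) + 1 / (4 * C) * n N = -(3 / (4 * C)) * n N := by
                field_simp
                ring
              linarith
            have hlogC : Real.log C ≤ 3 / (4 * C) * n N := by
              have := hn1N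
              rw [div_mul_eq_mul_div, div_le_iff₀ (by norm_num : (0 : ℝ) < 3)] at this
              rw [div_mul_eq_mul_div, le_div_iff₀ (by positivity)]
              nlinarith
            calc C * Real.exp (-(C⁻¹ * n N)) * Real.exp (4 * γ * K' * n N)
                = C * Real.exp (-(C⁻¹ * n N) + 4 * γ * K' * n N) := by
                  rw [mul_assoc, ← Real.exp_add]
              _ ≤ C * Real.exp (-(3 / (4 * C)) * n N) := by
                  gcongr
              _ = Real.exp (Real.log C + -(3 / (4 * C)) * n N) := by
                  rw [Real.exp_add, Real.exp_log hC]
              _ ≤ Real.exp 0 := Real.exp_le_exp.2 (by linarith)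
              _ = 1 := Real.exp_zero
          calc (C * Real.exp (-(C⁻¹ * n N)) * Real.exp (4 * γ * K' * n N)) ^ (1 / (2 : ℝ))
              ≤ (1 : ℝ) ^ (1 / (2 : ℝ)) := by
                gcongr
            _ = 1 := Real.one_rpow _
      _ = 1 := ENNReal.ofReal_one
  have hYfac : (∫⁻ ω, ENNReal.ofReal (Real.exp (2 * γ * Y N ω)) ∂μ N) ^ (1 / (2 : ℝ)) ≤
      ENNReal.ofReal ((2 * Real.exp (2 * γ * (ε / 4 * n N))) ^ (1 / (2 : ℝ))) := by
    have hle : ∫⁻ ω, ENNReal.ofReal (Real.exp (2 * γ * Y N ω)) ∂μ N ≤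
        ENNReal.ofReal (2 * Real.exp (2 * γ * (ε / 4 * n N))) := by
      calc ∫⁻ ω, ENNReal.ofReal (Real.exp (2 * γ * Y N ω)) ∂μ N
          ≤ ENNReal.ofReal (Real.exp (2 * γ * (ε / 4 * n N))) + 1 := by
            refine hYtrunc.trans ?_
            gcongr
        _ ≤ ENNReal.ofReal (Real.exp (2 * γ * (ε / 4 * n N))) +
              ENNReal.ofReal (Real.exp (2 * γ * (ε / 4 * n N))) := by
            gcongr
            rw [← ENNReal.ofReal_one]
            exact ENNReal.ofReal_le_ofReal (Real.one_le_exp (by positivity))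
        _ = ENNReal.ofReal (2 * Real.exp (2 * γ * (ε / 4 * n N))) := by
            rw [show (2 : ℝ) * Real.exp (2 * γ * (ε / 4 * n N)) =
                Real.exp (2 * γ * (ε / 4 * n N)) + Real.exp (2 * γ * (ε / 4 * n N)) by ring,
              ENNReal.ofReal_add (by positivity) (by positivity)]
    calc (∫⁻ ω, ENNReal.ofReal (Real.exp (2 * γ * Y N ω)) ∂μ N) ^ (1 / (2 : ℝ))
        ≤ (ENNReal.ofReal (2 * Real.exp (2 * γ * (ε / 4 * n N)))) ^ (1 / (2 : ℝ)) := by gcongr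
      _ = _ := ofReal_rpow_half (by positivity)
  -- Step 4: assemble, `√2 · e^{γ ε n / 2} ≤ e^{γ ε n}` since `n ≥ log 2 / (γ ε)`
  calc (∫⁻ ω, ENNReal.ofReal (Real.exp (2 * γ * X N ω)) ∂μ N) ^ (1 / (2 : ℝ)) *
        (∫⁻ ω, ENNReal.ofReal (Real.exp (2 * γ * Y N ω)) ∂μ N) ^ (1 / (2 : ℝ))
      ≤ ENNReal.ofReal (Real.exp (γ * (ε / 4) * n N)) *
          ENNReal.ofReal ((2 * Real.exp (2 * γ * (ε / 4 * n N))) ^ (1 / (2 : ℝ))) := by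
        gcongr
    _ = ENNReal.ofReal (Real.exp (γ * (ε / 4) * n N) *
          (2 * Real.exp (2 * γ * (ε / 4 * n N))) ^ (1 / (2 : ℝ))) :=
        (ENNReal.ofReal_mul (by positivity)).symm
    _ ≤ ENNReal.ofReal (Real.exp (γ * ε * n N)) := by
        refine ENNReal.ofReal_le_ofReal ?_
        have hsq : (2 * Real.exp (2 * γ * (ε / 4 * n N))) ^ (1 / (2 : ℝ)) =
            (2 : ℝ) ^ (1 / (2 : ℝ)) * Real.exp (γ * (ε / 4) * n N) := by
          rw [Real.mul_rpow (by norm_num) (by positivity), ← Real.exp_mul]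
          congr 2
          ring
        rw [hsq]
        have h2 : (2 : ℝ) ^ (1 / (2 : ℝ)) ≤ Real.exp (γ * (ε / 2) * n N) := by
          have hlog : Real.log 2 ≤ γ * ε * n N := by
            have := hn2N
            rw [div_le_iff₀ (by positivity)] at this
            linarith
          calc (2 : ℝ) ^ (1 / (2 : ℝ)) = Real.exp (Real.log 2 * (1 / 2)) := by
                rw [Real.rpow_def_of_pos (by norm_num)]
            _ ≤ Real.exp (γ * (ε / 2) * n N) := Real.exp_le_exp.2 (by nlinarith)
        calc Real.exp (γ * (ε / 4) * n N) * ((2 : ℝ) ^ (1 / (2 : ℝ)) * Real.exp (γ * (ε / 4) * n N))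
            ≤ Real.exp (γ * (ε / 4) * n N) *
                (Real.exp (γ * (ε / 2) * n N) * Real.exp (γ * (ε / 4) * n N)) := by
              gcongr
          _ = Real.exp (γ * ε * n N) := by
              rw [← Real.exp_add, ← Real.exp_add]
              congr 1
              ring

end Summit.AtomisticToContinuum.HydrodynamicLimit.Theorems.RestartPrinciple.IsentropicRegibbsification

end
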